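import Summits.Ventures.DiscreteObjects.Hadamard.ConferenceGraph333GroupCensus
import Summits.Ventures.DiscreteObjects.Hadamard.ConferenceGraph333OrderCensusA
import Summits.Ventures.DiscreteObjects.Hadamard.ConferenceGraph333OrderCensusB
import Summits.Ventures.DiscreteObjects.Hadamard.ConferenceGraph333OrderCensusC
import Summits.Ventures.DiscreteObjects.Hadamard.ConferenceGraph333GroupOrbits

/-!
# Orders of automorphisms of srg(333,166,82,83): the census in `orderOf` form (kernel summary, gen 29)

Framing: lottery ticket; floor = certified bounds/negative ranges.  Cell pub-namedobj (venture DiscreteObjects),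
target (H) = `H(668)`, hadamard gen 29.  One-stop statements of the element-order census of `srg(333,166,82,83)` ⇔ symmetric
`C(334)` (gens 28–29), for an adjacency-preserving permutation `σ`:
* **`aut_prime_dvd_orderOf`** — every prime divisor of `orderOf σ` lies in `{2, 3, 5, 7, 11, 13, 23, 37, 41, 83}`;
* **`aut_orderOf_not_dvd`** — `m ∤ orderOf σ` for every
  `m ∈ {17, 49, 69, 85, 91, 92, 98, 99, 100, 110, 111, 112, 115, 117, 119, 121, 123, 125, 128, 135, 138, 143, 147, 150, 154, 156, 160, 161, 162, 164, 165, 169, 185, 249}`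
  (each from the corresponding `no_aut_order_m` applied to `σ ^ (orderOf σ / m)`, which has order exactly `m`);
* **`aut_orderOf_odd_fixed`** — if `37 ∤ orderOf σ` then `#Fix σ` is odd (restated with `orderOf`).
Script level (exact, code/order_census_g29.py): together with the windows these leave the 71 admissible orders listed in
`ConferenceGraph333OrderCensusA` (maximum `166`); `126, 140, 144` are excluded there but not yet in the kernel.
Structure of a HYPOTHETICAL object; ours (PROVISIONAL).  No `sorry`, no new definitions.
-/

namespace Summit.Ventures.DiscreteObjects.Hadamard

open Finset

section ordersummary
variable {V : Type*} [Fintype V] [DecidableEq V]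

omit [DecidableEq V] in
/-- the power `σ ^ (orderOf σ / m)` has order exactly `m` (`m ∣ orderOf σ`): its `m`-th power is `1` and no smaller positive power is. -/
theorem pow_orderOf_div_facts (σ : Equiv.Perm V) {m : ℕ} (hdvd : m ∣ orderOf σ) :
    (σ ^ (orderOf σ / m)) ^ m = 1 ∧ ∀ j, 0 < j → j < m → (σ ^ (orderOf σ / m)) ^ j ≠ 1 := by
  have hτ : orderOf (σ ^ (orderOf σ / m)) = m := orderOf_pow_orderOf_div (orderOf_pos σ).ne' hdvd
  have h1 := pow_orderOf_eq_one (σ ^ (orderOf σ / m))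
  rw [hτ] at h1
  exact ⟨h1, fun j hj hjm => pow_ne_one_of_lt_orderOf hj.ne' (by rw [hτ]; exact hjm)⟩

/-- **Prime divisors of the order of an automorphism.** -/
theorem aut_prime_dvd_orderOf (hV : Fintype.card V = 333) (A : Matrix V V ℤ)
    (h01 : ∀ x y, A x y = 0 ∨ A x y = 1) (hsymm : ∀ x y, A y x = A x y) (hdiag : ∀ x, A x x = 0)
    (hk : ∀ x, ∑ y, A x y = 166) (hsrg : ∀ x y, ∑ z, A x z * A z y = 83 * (1 + (if x = y then 1 else 0)) - A x y)
    (σ : Equiv.Perm V) (hA : ∀ x y, A (σ x) (σ y) = A x y) {p : ℕ} (hp : p.Prime) (hdvd : p ∣ orderOf σ) :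
    p = 2 ∨ p = 3 ∨ p = 5 ∨ p = 7 ∨ p = 11 ∨ p = 13 ∨ p = 23 ∨ p = 37 ∨ p = 41 ∨ p = 83 := by
  have hAk := adj_pow_invariant A σ hA
  obtain ⟨h1, hne⟩ := pow_orderOf_div_facts σ hdvd
  have hne1 : σ ^ (orderOf σ / p) ≠ 1 := by
    have := hne 1 one_pos hp.one_lt
    rwa [pow_one] at this
  exact aut_prime_spectrum_refined hV A h01 hsymm hdiag hk hsrg hp _ h1 hne1 (hAk _)

/-- **Odd fixed points, `orderOf` form.** -/
theorem aut_orderOf_odd_fixed (hV : Fintype.card V = 333) (A : Matrix V V ℤ)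
    (h01 : ∀ x y, A x y = 0 ∨ A x y = 1) (hsymm : ∀ x y, A y x = A x y) (hdiag : ∀ x, A x x = 0)
    (hk : ∀ x, ∑ y, A x y = 166) (hsrg : ∀ x y, ∑ z, A x z * A z y = 83 * (1 + (if x = y then 1 else 0)) - A x y)
    (σ : Equiv.Perm V) (hA : ∀ x y, A (σ x) (σ y) = A x y) (h37 : ¬ 37 ∣ orderOf σ) :
    (univ.filter fun x => σ x = x).card % 2 = 1 :=
  (aut_card_fixed_odd hV A h01 hsymm hdiag hk hsrg σ (pow_orderOf_eq_one σ) h37 hA).2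

/-- **Excluded divisors of `orderOf σ`.** -/
theorem aut_orderOf_not_dvd (hV : Fintype.card V = 333) (A : Matrix V V ℤ)
    (h01 : ∀ x y, A x y = 0 ∨ A x y = 1) (hsymm : ∀ x y, A y x = A x y) (hdiag : ∀ x, A x x = 0)
    (hk : ∀ x, ∑ y, A x y = 166) (hsrg : ∀ x y, ∑ z, A x z * A z y = 83 * (1 + (if x = y then 1 else 0)) - A x y)
    (σ : Equiv.Perm V) (hA : ∀ x y, A (σ x) (σ y) = A x y) {m : ℕ}
    (hm : m ∈ ({17, 49, 69, 85, 91, 92, 98, 99, 100, 110, 111, 112, 115, 117, 119, 121, 123, 125, 128, 135, 138, 143, 147, 150, 154, 156, 160, 161, 162, 164, 165, 169, 185, 249} : Finset ℕ)) : ¬ m ∣ orderOf σ := by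
  intro hdvd
  have hAk := adj_pow_invariant A σ hA
  obtain ⟨h1, hne⟩ := pow_orderOf_div_facts σ hdvd
  simp only [Finset.mem_insert, Finset.mem_singleton] at hm
  rcases hm with rfl | rfl | rfl | rfl | rfl | rfl | rfl | rfl | rfl | rfl | rfl | rfl | rfl | rfl | rfl | rfl | rfl | rfl | rfl | rfl | rfl | rfl | rfl | rfl | rfl | rfl | rfl | rfl | rfl | rfl | rfl | rfl | rfl | rfl
  · exact no_aut_order_17 hV A h01 hsymm hdiag hk hsrg (σ ^ (orderOf σ / 17)) h1 (by
      have := hne 1 one_pos (by norm_num); rwa [pow_one] at this) (hAk _)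
  · exact no_aut_order_49 hV A h01 hsymm hdiag hk hsrg (σ ^ (orderOf σ / 49)) h1 (hne 7 (by norm_num) (by norm_num)) (hAk _)
  · exact no_aut_order_69 hV A h01 hsymm hdiag hk hsrg (σ ^ (orderOf σ / 69)) h1 (hne 3 (by norm_num) (by norm_num)) (hne 23 (by norm_num) (by norm_num)) (hAk _)
  · exact no_aut_order_85 hV A h01 hsymm hdiag hk hsrg (σ ^ (orderOf σ / 85)) (by norm_num [h1] : (σ ^ (orderOf σ / 85)) ^ (5 * 17) = 1)
      (hne 5 (by norm_num) (by norm_num)) (hne 17 (by norm_num) (by norm_num)) (hAk _)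
  · exact no_aut_order_91 hV A h01 hsymm hdiag hk hsrg (σ ^ (orderOf σ / 91)) (by norm_num [h1] : (σ ^ (orderOf σ / 91)) ^ (7 * 13) = 1)
      (hne 7 (by norm_num) (by norm_num)) (hne 13 (by norm_num) (by norm_num)) (hAk _)
  · exact no_aut_order_92 hV A h01 hsymm hdiag hk hsrg (σ ^ (orderOf σ / 92)) h1 (hne 46 (by norm_num) (by norm_num)) (hne 4 (by norm_num) (by norm_num)) (hAk _)
  · exact no_aut_order_98 hV A h01 hsymm hdiag hk hsrg (σ ^ (orderOf σ / 98)) h1 (hne 49 (by norm_num) (by norm_num)) (hne 14 (by norm_num) (by norm_num)) (hAk _)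
  · exact no_aut_order_99 hV A h01 hsymm hdiag hk hsrg (σ ^ (orderOf σ / 99)) h1 (hne 9 (by norm_num) (by norm_num)) (hne 33 (by norm_num) (by norm_num)) (hAk _)
  · exact no_aut_order_100 hV A h01 hsymm hdiag hk hsrg (σ ^ (orderOf σ / 100)) h1 (hne 50 (by norm_num) (by norm_num)) (hne 20 (by norm_num) (by norm_num)) (hAk _)
  · exact no_aut_order_110 hV A h01 hsymm hdiag hk hsrg (σ ^ (orderOf σ / 110)) h1 (hne 55 (by norm_num) (by norm_num)) (hne 22 (by norm_num) (by norm_num)) (hne 10 (by norm_num) (by norm_num)) (hAk _)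
  · exact no_aut_order_111 hV A h01 hsymm hdiag hk hsrg (σ ^ (orderOf σ / 111)) (by norm_num [h1] : (σ ^ (orderOf σ / 111)) ^ (3 * 37) = 1)
      (hne 3 (by norm_num) (by norm_num)) (hne 37 (by norm_num) (by norm_num)) (hAk _)
  · exact no_aut_order_112 hV A h01 hsymm hdiag hk hsrg (σ ^ (orderOf σ / 112)) h1 (hne 56 (by norm_num) (by norm_num)) (hne 16 (by norm_num) (by norm_num)) (hAk _)
  · exact no_aut_order_115 hV A h01 hsymm hdiag hk hsrg (σ ^ (orderOf σ / 115)) (by norm_num [h1] : (σ ^ (orderOf σ / 115)) ^ (5 * 23) = 1)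
      (hne 5 (by norm_num) (by norm_num)) (hne 23 (by norm_num) (by norm_num)) (hAk _)
  · exact no_aut_order_117 hV A h01 hsymm hdiag hk hsrg (σ ^ (orderOf σ / 117)) h1 (hne 39 (by norm_num) (by norm_num)) (hne 9 (by norm_num) (by norm_num)) (hAk _)
  · exact no_aut_order_119 hV A h01 hsymm hdiag hk hsrg (σ ^ (orderOf σ / 119)) (by norm_num [h1] : (σ ^ (orderOf σ / 119)) ^ (7 * 17) = 1)
      (hne 7 (by norm_num) (by norm_num)) (hne 17 (by norm_num) (by norm_num)) (hAk _)
  · exact no_aut_order_121 hV A h01 hsymm hdiag hk hsrg (σ ^ (orderOf σ / 121)) h1 (hne 11 (by norm_num) (by norm_num)) (hAk _)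
  · exact no_aut_order_123 hV A h01 hsymm hdiag hk hsrg (σ ^ (orderOf σ / 123)) (by norm_num [h1] : (σ ^ (orderOf σ / 123)) ^ (3 * 41) = 1)
      (hne 3 (by norm_num) (by norm_num)) (hne 41 (by norm_num) (by norm_num)) (hAk _)
  · exact no_aut_order_125 hV A h01 hsymm hdiag hk hsrg (σ ^ (orderOf σ / 125)) h1 (hne 25 (by norm_num) (by norm_num)) (hAk _)
  · exact no_aut_order_128 hV A h01 hsymm hdiag hk hsrg (σ ^ (orderOf σ / 128)) h1 (hne 64 (by norm_num) (by norm_num)) (hAk _)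
  · exact no_aut_order_135 hV A h01 hsymm hdiag hk hsrg (σ ^ (orderOf σ / 135)) h1 (hne 45 (by norm_num) (by norm_num)) (hne 27 (by norm_num) (by norm_num)) (hAk _)
  · exact no_aut_order_138 hV A h01 hsymm hdiag hk hsrg (σ ^ (orderOf σ / 138)) h1 (hne 69 (by norm_num) (by norm_num)) (hne 46 (by norm_num) (by norm_num)) (hne 6 (by norm_num) (by norm_num)) (hAk _)
  · exact no_aut_order_143 hV A h01 hsymm hdiag hk hsrg (σ ^ (orderOf σ / 143)) (by norm_num [h1] : (σ ^ (orderOf σ / 143)) ^ (11 * 13) = 1)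
      (hne 11 (by norm_num) (by norm_num)) (hne 13 (by norm_num) (by norm_num)) (hAk _)
  · exact no_aut_order_147 hV A h01 hsymm hdiag hk hsrg (σ ^ (orderOf σ / 147)) h1 (hne 49 (by norm_num) (by norm_num)) (hne 21 (by norm_num) (by norm_num)) (hAk _)
  · exact no_aut_order_150 hV A h01 hsymm hdiag hk hsrg (σ ^ (orderOf σ / 150)) h1 (hne 75 (by norm_num) (by norm_num)) (hne 50 (by norm_num) (by norm_num)) (hne 30 (by norm_num) (by norm_num)) (hAk _)
  · exact no_aut_order_154 hV A h01 hsymm hdiag hk hsrg (σ ^ (orderOf σ / 154)) h1 (hne 77 (by norm_num) (by norm_num)) (hne 22 (by norm_num) (by norm_num)) (hne 14 (by norm_num) (by norm_num)) (hAk _)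
  · exact no_aut_order_156 hV A h01 hsymm hdiag hk hsrg (σ ^ (orderOf σ / 156)) h1 (hne 78 (by norm_num) (by norm_num)) (hne 52 (by norm_num) (by norm_num)) (hne 12 (by norm_num) (by norm_num)) (hAk _)
  · exact no_aut_order_160 hV A h01 hsymm hdiag hk hsrg (σ ^ (orderOf σ / 160)) h1 (hne 80 (by norm_num) (by norm_num)) (hne 32 (by norm_num) (by norm_num)) (hAk _)
  · exact no_aut_order_161 hV A h01 hsymm hdiag hk hsrg (σ ^ (orderOf σ / 161)) h1 (hne 23 (by norm_num) (by norm_num)) (hne 7 (by norm_num) (by norm_num)) (hAk _)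
  · exact no_aut_order_162 hV A h01 hsymm hdiag hk hsrg (σ ^ (orderOf σ / 162)) h1 (hne 81 (by norm_num) (by norm_num)) (hne 54 (by norm_num) (by norm_num)) (hAk _)
  · exact no_aut_order_164 hV A h01 hsymm hdiag hk hsrg (σ ^ (orderOf σ / 164)) h1 (hne 82 (by norm_num) (by norm_num)) (hne 4 (by norm_num) (by norm_num)) (hAk _)
  · exact no_aut_order_165 hV A h01 hsymm hdiag hk hsrg (σ ^ (orderOf σ / 165)) h1 (hne 55 (by norm_num) (by norm_num)) (hne 33 (by norm_num) (by norm_num)) (hne 15 (by norm_num) (by norm_num)) (hAk _)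
  · exact no_aut_order_169 hV A h01 hsymm hdiag hk hsrg (σ ^ (orderOf σ / 169)) h1 (hne 13 (by norm_num) (by norm_num)) (hAk _)
  · exact no_aut_order_185 hV A h01 hsymm hdiag hk hsrg (σ ^ (orderOf σ / 185)) (by norm_num [h1] : (σ ^ (orderOf σ / 185)) ^ (5 * 37) = 1)
      (hne 5 (by norm_num) (by norm_num)) (hne 37 (by norm_num) (by norm_num)) (hAk _)
  · exact no_aut_order_249 hV A h01 hsymm hdiag hk hsrg (σ ^ (orderOf σ / 249)) (by norm_num [h1] : (σ ^ (orderOf σ / 249)) ^ (3 * 83) = 1)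
      (hne 3 (by norm_num) (by norm_num)) (hne 83 (by norm_num) (by norm_num)) (hAk _)

end ordersummary

end Summit.Ventures.DiscreteObjects.Hadamard
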